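import Summits.BirchSwinnertonDyer.BirchSwinnertonDyer.Theorems.KatoDescentPotSupersingularWildFineSelmerCoinvariantL12Records01
import HarnessLib

/-!
# Route `KatoDescentPotSupersingular` (rung K9, sub-rung B5 = O6 wild `p = 3`, cell `bsd-potss`): per-row records on the FACT-FREE door L12
# (ONE-PAIR-OF-LAYERS COINVARIANT CRITERION at `ℚ(P)`, layers `(1, 2)`), part 02: a further, INDEPENDENT fact-free road for the three rows of the
# octic `x^8 - 2x^7 + 2x^6 + 8x^5 - 33x^4 + 75x^3 - 126x^2 + 99x - 27` — 406593q1 (the last 19942 residue row), 406593f1, 406593n1 — whose first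
# fact-free records are conjA-anchor g21's door-L11 records (`…CentralLayerL11Records01`, displayed `hσ` from kit j329384) and, for 406593n1, k9-c4
# g25's door-L5 record (seat `bsd-potss-k9-c4` g26; `--supports stmt-BirchSwinnertonDyer-19197 --as helper`)

HONEST FRAMING. THEOREMS ONLY (no definition, no named fact, no `sorry`); PER ROW — NOT a class theorem; nothing is booked; items 19189 / 19197 / 19942 /
19386 stay OPEN at class level; Conjecture A and BSD are proved for NO class of curves.  The doors are those of part 01 (`conjA_three_of_Δ_eq_cube_of_coinvariant_index_le`,
`missingUpperBoundAt_three_of_Δ_eq_cube_of_coinvariant_index_le`: L8 ∘ L12, Fukuda index and tameness from `Δ` a cube, all kernel); each theorem is CONDITIONAL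
on the displayed hypothesis `hco` («for every `P ≠ 0` and every cyclotomic `κ_P` of `ℚ(P)`, the `Gal(ℚ(P)₂/ℚ(P)₁)`-coinvariants of `Cl(ℚ(P)₂)/3` have `3`-rank `≤ 2`»),
a GENUS-THEORY datum of the degree-24 field `ℚ(P)₁` (GRH), NOT certified in the kernel — a DIFFERENT numeric input from the L11 records' `hσ` («`Gal(ℚ(P)₁/ℚ(P))` acts
trivially on `Cl(ℚ(P)₁)/3`», conjA-anchor g20 kit j329384): here k9-c4 g23's kit j316734 (`capit23.gp`, `bnfinit` flag 1, GRH): `ℚ(P)₁` degree 24, `h = 9`, `Cl = [3,3]`,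
`s = 5` primes above `3` all totally ramified in `ℚ(P)₂/ℚ(P)₁`, unit symbol rank `r_E = 2`, `dim ker i = 0` ⟹ coinvariant `3`-rank `(5−1−2) + 0 = 2` (`#(A(ℚ(P)₂))_G = 81 ≅ [9,9]`).
The identification of `fixedField (Stab P)` with `ℚ[x]/(K8)` for all three rows is the cell census' (conjA-anchor g19/g20, k9-c4 g23), not a kernel statement.
KERNEL lemmas are IMPORTED (`irr_g…_3`, `classO6_g…_3`, `Δ_eq_cube_g406593q1`, `WildFineSelmerCentralLayerL11Records.Δ_cube_g406593f1`,
`WildFineSelmerLayerOneL5Records.Δ_cube_g406593n1`).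

References: [CoatesSujatha2005] Thm. 3.4, Lemma 3.8; [Washington1997] §13.3 Lemma 13.18, Prop. 13.22–13.23; [Fukuda1994] Thm. 1 (proof, p. 264); [Lang1990]
Ch. 13 §4; [NeukirchANT1999] Ch. IV §6, Ch. VI §7 Thm. (7.1); [Serre1972] §2.4 Prop. 15, §5.3; [Kato2004Asterisque] Thm. 14.5 (3), Prop. 14.16 (2);
[Cremona2006] Table 1.
-/

set_option autoImplicit false
set_option linter.dupNamespace false

noncomputable section

open scoped Classical NumberField
open WeierstrassCurve NumberField Field IsDedekindDomain IntermediateField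
  Literature.NumberTheory.EllipticCurves Literature.NumberTheory.EllipticCurves.Rank1Residual
  Literature.NumberTheory.EllipticCurves.Rank1Residual.Typed
  Literature.NumberTheory.GaloisRepresentations Literature.NumberTheory.NumberFields
  Literature.NumberTheory.SerreUniformity Literature.NumberTheory.IwasawaTheory
  Summit.BirchSwinnertonDyer.Rank1Residual Summit.BirchSwinnertonDyer.Rank1Residual.Additive
  Summit.BirchSwinnertonDyer.BirchSwinnertonDyer.Theorems
  Summit.BirchSwinnertonDyer.BirchSwinnertonDyer.Theorems.AdditiveBranchIMCGordTwoRankOne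
  Summit.BirchSwinnertonDyer.BirchSwinnertonDyer.Theorems.WildUpperUnitTwistRecords

namespace Summit.BirchSwinnertonDyer.BirchSwinnertonDyer.Theorems.WildFineSelmerCoinvariantL12Records

/-! ## §1 The rows (doors of part 01) -/

/-! ### `406593q1` @ `p = 3` — `N = 406593 = 3^3·11·37^2`; Cremona: `r_an = 0`; O6 wild at `3`; image `3Nn`; `ℚ(P)` = the octic above; the last 19942 residue row — first fact-free road = door L11 (conjA-anchor g21, p724077); LAYERS (1,2) (kit j316734, GRH): `Cl(ℚ(P)₁) = [3,3]`, `s = 5`, `r_E = 2`, `dim ker i = 0`: coinvariant `3`-rank `2`. -/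

/-- **(A) AT `(406593q1, 3)` — NO NAMED FACT** (door L12 ∘ L8): KERNEL `irr_g406593q1_3`, `Δ_eq_cube_g406593q1`; DISPLAYED `hco` («the `Gal(ℚ(P)₂/ℚ(P)₁)`-coinvariants
of `Cl(ℚ(P)₂)/3` have `3`-rank `≤ 2`», every `P ≠ 0`, every cyclotomic `κ_P`; kit j316734: genus theory in `ℚ(P)₁`, `(s−1−r_E) + dim ker i = 2 + 0 = 2`, GRH).
Per row; nothing booked; (A)/BSD proved for no class. [cite: CoatesSujatha2005, §3 Thm. 3.4 and Lemma 3.8] [cite: Washington1997, §13.3 Lemma 13.18 and Prop. 13.22]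
[cite: Lang1990, Ch. 13 §4] [cite: Cremona2006, Table 1 (Cremona label 406593q1)] -/
theorem conjA_g406593q1_3_L12
    {W : WeierstrassCurve ℚ} [W.IsElliptic] (hWeq : W = (⟨0, 0, 1, (-12308679), 16382509841⟩ : WeierstrassCurve ℚ))
    (P : ↥(W.geomTorsion ((3 : ℕ) : ℤ))) (hP0 : P ≠ 0)
    (hco : ∀ κP : ZpExtension ↥(fixedField (MulAction.stabilizer (absoluteGaloisGroup ℚ) P) :
        IntermediateField ℚ (AlgebraicClosure ℚ)) 3, κP.IsCyclotomic →
      ((powMonoidHom 3 : ClassGroup (𝓞 ↥(κP.layer (0 + (1 + 1)))) →* ClassGroup (𝓞 ↥(κP.layer (0 + (1 + 1))))).range ⊔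
        Subgroup.closure {x | ∃ (σ : ↥(κP.layer (0 + (1 + 1))) ≃ₐ[↥(fixedField (MulAction.stabilizer (absoluteGaloisGroup ℚ) P) :
              IntermediateField ℚ (AlgebraicClosure ℚ))] ↥(κP.layer (0 + (1 + 1))))
          (_ : ∀ y : ↥(κP.layer (0 + (1 + 1))), ((y : ↥(κP.layer (0 + (1 + 1)))) :
              AlgebraicClosure ↥(fixedField (MulAction.stabilizer (absoluteGaloisGroup ℚ) P) : IntermediateField ℚ (AlgebraicClosure ℚ))) ∈
              κP.layer (0 + 1) → σ y = y)
          (x' : ClassGroup (𝓞 ↥(κP.layer (0 + (1 + 1))))), x = ClassGroup.mulEquiv (AmbiguousClass.intAut σ) x' * x'⁻¹}).index ≤ 3 ^ 2)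
    (κ : ZpExtension ℚ 3) (hκ : κ.IsCyclotomic) :
    ∃ (γ : absoluteGaloisGroup ℚ) (Df : W.FineSelmerDualData κ γ),
      Module.Finite ℤ_[3] (RestrictScalars ℤ_[3] (IwasawaAlgebra 3) Df.X) := by
  subst hWeq
  exact conjA_three_of_Δ_eq_cube_of_coinvariant_index_le _ irr_g406593q1_3 Δ_eq_cube_g406593q1 P hP0 hco κ hκ

/-- **RECORD — U₀ `ord₃ #Ш(E) ≤ ord₃ #Ш(E)_an` for `E = 406593q1` at `p = 3` on the fact-free door L12** (U₀-ns row of K9 items 19189 / 19197; a further independent road): KERNEL `classO6_g406593q1_3`,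
`irr_g406593q1_3`, `Δ_eq_cube_g406593q1`; DISPLAYED named facts `hKatoA hGZK hmod` ONLY, Cremona's `r_an = 0` (`hr`), and `hco` (kit j316734, GRH). Per row; nothing booked;
BSD is not proved by this. [cite: Kato2004Asterisque, Thm. 14.5 (3) (p. 236) and Prop. 14.16 (2)] [cite: CoatesSujatha2005, §3 Thm. 3.4]
[cite: Cremona2006, Table 1 (Cremona label 406593q1)] -/
theorem missingUpperBoundAt_g406593q1_3_L12
    (hKatoA : Kato2004.rankZero_padicValNat_sha_add_padicValNat_tamagawa_le_of_additive_potGood_of_irreducible_of_fineSelmerDual_fg)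
    (hGZK : rank_eq_analyticRank_of_analyticRank_le_one) (hmod : hasEntireLFunction_rat)
    {W : WeierstrassCurve ℚ} [W.IsElliptic] [W.IsGloballyMinimal] (hWeq : W = (⟨0, 0, 1, (-12308679), 16382509841⟩ : WeierstrassCurve ℚ))
    (hr : W.analyticRank = 0) (P : ↥(W.geomTorsion ((3 : ℕ) : ℤ))) (hP0 : P ≠ 0)
    (hco : ∀ κP : ZpExtension ↥(fixedField (MulAction.stabilizer (absoluteGaloisGroup ℚ) P) :
        IntermediateField ℚ (AlgebraicClosure ℚ)) 3, κP.IsCyclotomic →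
      ((powMonoidHom 3 : ClassGroup (𝓞 ↥(κP.layer (0 + (1 + 1)))) →* ClassGroup (𝓞 ↥(κP.layer (0 + (1 + 1))))).range ⊔
        Subgroup.closure {x | ∃ (σ : ↥(κP.layer (0 + (1 + 1))) ≃ₐ[↥(fixedField (MulAction.stabilizer (absoluteGaloisGroup ℚ) P) :
              IntermediateField ℚ (AlgebraicClosure ℚ))] ↥(κP.layer (0 + (1 + 1))))
          (_ : ∀ y : ↥(κP.layer (0 + (1 + 1))), ((y : ↥(κP.layer (0 + (1 + 1)))) :
              AlgebraicClosure ↥(fixedField (MulAction.stabilizer (absoluteGaloisGroup ℚ) P) : IntermediateField ℚ (AlgebraicClosure ℚ))) ∈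
              κP.layer (0 + 1) → σ y = y)
          (x' : ClassGroup (𝓞 ↥(κP.layer (0 + (1 + 1))))), x = ClassGroup.mulEquiv (AmbiguousClass.intAut σ) x' * x'⁻¹}).index ≤ 3 ^ 2) :
    MissingUpperBoundAt W 3 := by
  subst hWeq
  exact missingUpperBoundAt_three_of_Δ_eq_cube_of_coinvariant_index_le hKatoA hGZK hmod _ hr classO6_g406593q1_3 irr_g406593q1_3
    Δ_eq_cube_g406593q1 P hP0 hco


/-! ### `406593f1` @ `p = 3` — `N = 406593`; Cremona: `r_an = 0`, `∏ c_ℓ = 12`; O6 wild at `3`; `Δ = (-18387039)³`; `ℚ(P)` = the octic above (census); first fact-free road = door L11 (p724077); LAYERS (1,2) (kit j316734, GRH): `Cl(ℚ(P)₁) = [3,3]`, `s = 5`, `r_E = 2`, `dim ker i = 0`: coinvariant `3`-rank `2`. -/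

/-- **(A) AT `(406593f1, 3)` — NO NAMED FACT** (door L12 ∘ L8): KERNEL `irr_g406593f1_3`, `WildFineSelmerCentralLayerL11Records.Δ_cube_g406593f1`; DISPLAYED `hco` («the `Gal(ℚ(P)₂/ℚ(P)₁)`-coinvariants
of `Cl(ℚ(P)₂)/3` have `3`-rank `≤ 2`», every `P ≠ 0`, every cyclotomic `κ_P`; kit j316734: genus theory in `ℚ(P)₁`, `(s−1−r_E) + dim ker i = 2 + 0 = 2`, GRH).
Per row; nothing booked; (A)/BSD proved for no class. [cite: CoatesSujatha2005, §3 Thm. 3.4 and Lemma 3.8] [cite: Washington1997, §13.3 Lemma 13.18 and Prop. 13.22]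
[cite: Lang1990, Ch. 13 §4] [cite: Cremona2006, Table 1 (Cremona label 406593f1)] -/
theorem conjA_g406593f1_3_L12
    {W : WeierstrassCurve ℚ} [W.IsElliptic] (hWeq : W = (⟨1, (-1), 1, (-4530278), (-5305847140)⟩ : WeierstrassCurve ℚ))
    (P : ↥(W.geomTorsion ((3 : ℕ) : ℤ))) (hP0 : P ≠ 0)
    (hco : ∀ κP : ZpExtension ↥(fixedField (MulAction.stabilizer (absoluteGaloisGroup ℚ) P) :
        IntermediateField ℚ (AlgebraicClosure ℚ)) 3, κP.IsCyclotomic →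
      ((powMonoidHom 3 : ClassGroup (𝓞 ↥(κP.layer (0 + (1 + 1)))) →* ClassGroup (𝓞 ↥(κP.layer (0 + (1 + 1))))).range ⊔
        Subgroup.closure {x | ∃ (σ : ↥(κP.layer (0 + (1 + 1))) ≃ₐ[↥(fixedField (MulAction.stabilizer (absoluteGaloisGroup ℚ) P) :
              IntermediateField ℚ (AlgebraicClosure ℚ))] ↥(κP.layer (0 + (1 + 1))))
          (_ : ∀ y : ↥(κP.layer (0 + (1 + 1))), ((y : ↥(κP.layer (0 + (1 + 1)))) :
              AlgebraicClosure ↥(fixedField (MulAction.stabilizer (absoluteGaloisGroup ℚ) P) : IntermediateField ℚ (AlgebraicClosure ℚ))) ∈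
              κP.layer (0 + 1) → σ y = y)
          (x' : ClassGroup (𝓞 ↥(κP.layer (0 + (1 + 1))))), x = ClassGroup.mulEquiv (AmbiguousClass.intAut σ) x' * x'⁻¹}).index ≤ 3 ^ 2)
    (κ : ZpExtension ℚ 3) (hκ : κ.IsCyclotomic) :
    ∃ (γ : absoluteGaloisGroup ℚ) (Df : W.FineSelmerDualData κ γ),
      Module.Finite ℤ_[3] (RestrictScalars ℤ_[3] (IwasawaAlgebra 3) Df.X) := by
  subst hWeq
  exact conjA_three_of_Δ_eq_cube_of_coinvariant_index_le _ irr_g406593f1_3 WildFineSelmerCentralLayerL11Records.Δ_cube_g406593f1 P hP0 hco κ hκ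

/-- **RECORD — U₀ `ord₃ #Ш(E) ≤ ord₃ #Ш(E)_an` for `E = 406593f1` at `p = 3` on the fact-free door L12** (U₀-ns row of K9 items 19189 / 19197; a further independent road): KERNEL `classO6_g406593f1_3`,
`irr_g406593f1_3`, `WildFineSelmerCentralLayerL11Records.Δ_cube_g406593f1`; DISPLAYED named facts `hKatoA hGZK hmod` ONLY, Cremona's `r_an = 0` (`hr`), and `hco` (kit j316734, GRH). Per row; nothing booked;
BSD is not proved by this. [cite: Kato2004Asterisque, Thm. 14.5 (3) (p. 236) and Prop. 14.16 (2)] [cite: CoatesSujatha2005, §3 Thm. 3.4]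
[cite: Cremona2006, Table 1 (Cremona label 406593f1)] -/
theorem missingUpperBoundAt_g406593f1_3_L12
    (hKatoA : Kato2004.rankZero_padicValNat_sha_add_padicValNat_tamagawa_le_of_additive_potGood_of_irreducible_of_fineSelmerDual_fg)
    (hGZK : rank_eq_analyticRank_of_analyticRank_le_one) (hmod : hasEntireLFunction_rat)
    {W : WeierstrassCurve ℚ} [W.IsElliptic] [W.IsGloballyMinimal] (hWeq : W = (⟨1, (-1), 1, (-4530278), (-5305847140)⟩ : WeierstrassCurve ℚ))
    (hr : W.analyticRank = 0) (P : ↥(W.geomTorsion ((3 : ℕ) : ℤ))) (hP0 : P ≠ 0)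
    (hco : ∀ κP : ZpExtension ↥(fixedField (MulAction.stabilizer (absoluteGaloisGroup ℚ) P) :
        IntermediateField ℚ (AlgebraicClosure ℚ)) 3, κP.IsCyclotomic →
      ((powMonoidHom 3 : ClassGroup (𝓞 ↥(κP.layer (0 + (1 + 1)))) →* ClassGroup (𝓞 ↥(κP.layer (0 + (1 + 1))))).range ⊔
        Subgroup.closure {x | ∃ (σ : ↥(κP.layer (0 + (1 + 1))) ≃ₐ[↥(fixedField (MulAction.stabilizer (absoluteGaloisGroup ℚ) P) :
              IntermediateField ℚ (AlgebraicClosure ℚ))] ↥(κP.layer (0 + (1 + 1))))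
          (_ : ∀ y : ↥(κP.layer (0 + (1 + 1))), ((y : ↥(κP.layer (0 + (1 + 1)))) :
              AlgebraicClosure ↥(fixedField (MulAction.stabilizer (absoluteGaloisGroup ℚ) P) : IntermediateField ℚ (AlgebraicClosure ℚ))) ∈
              κP.layer (0 + 1) → σ y = y)
          (x' : ClassGroup (𝓞 ↥(κP.layer (0 + (1 + 1))))), x = ClassGroup.mulEquiv (AmbiguousClass.intAut σ) x' * x'⁻¹}).index ≤ 3 ^ 2) :
    MissingUpperBoundAt W 3 := by
  subst hWeq
  exact missingUpperBoundAt_three_of_Δ_eq_cube_of_coinvariant_index_le hKatoA hGZK hmod _ hr classO6_g406593f1_3 irr_g406593f1_3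
    WildFineSelmerCentralLayerL11Records.Δ_cube_g406593f1 P hP0 hco


/-! ### `406593n1` @ `p = 3` — `N = 406593`; Cremona: `r_an = 0`, `∏ c_ℓ = 12`; O6 wild at `3`; `Δ = (-13431)³`; `ℚ(P)` = the octic above (census); earlier fact-free roads = door L5 (k9-c4 g25) and door L11 (p724077); LAYERS (1,2) (kit j316734, GRH): `Cl(ℚ(P)₁) = [3,3]`, `s = 5`, `r_E = 2`, `dim ker i = 0`: coinvariant `3`-rank `2`. -/

/-- **(A) AT `(406593n1, 3)` — NO NAMED FACT** (door L12 ∘ L8): KERNEL `irr_g406593n1_3`, `WildFineSelmerLayerOneL5Records.Δ_cube_g406593n1`; DISPLAYED `hco` («the `Gal(ℚ(P)₂/ℚ(P)₁)`-coinvariants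
of `Cl(ℚ(P)₂)/3` have `3`-rank `≤ 2`», every `P ≠ 0`, every cyclotomic `κ_P`; kit j316734: genus theory in `ℚ(P)₁`, `(s−1−r_E) + dim ker i = 2 + 0 = 2`, GRH).
Per row; nothing booked; (A)/BSD proved for no class. [cite: CoatesSujatha2005, §3 Thm. 3.4 and Lemma 3.8] [cite: Washington1997, §13.3 Lemma 13.18 and Prop. 13.22]
[cite: Lang1990, Ch. 13 §4] [cite: Cremona2006, Table 1 (Cremona label 406593n1)] -/
theorem conjA_g406593n1_3_L12
    {W : WeierstrassCurve ℚ} [W.IsElliptic] (hWeq : W = (⟨1, (-1), 0, (-3309), (-103944)⟩ : WeierstrassCurve ℚ))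
    (P : ↥(W.geomTorsion ((3 : ℕ) : ℤ))) (hP0 : P ≠ 0)
    (hco : ∀ κP : ZpExtension ↥(fixedField (MulAction.stabilizer (absoluteGaloisGroup ℚ) P) :
        IntermediateField ℚ (AlgebraicClosure ℚ)) 3, κP.IsCyclotomic →
      ((powMonoidHom 3 : ClassGroup (𝓞 ↥(κP.layer (0 + (1 + 1)))) →* ClassGroup (𝓞 ↥(κP.layer (0 + (1 + 1))))).range ⊔
        Subgroup.closure {x | ∃ (σ : ↥(κP.layer (0 + (1 + 1))) ≃ₐ[↥(fixedField (MulAction.stabilizer (absoluteGaloisGroup ℚ) P) :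
              IntermediateField ℚ (AlgebraicClosure ℚ))] ↥(κP.layer (0 + (1 + 1))))
          (_ : ∀ y : ↥(κP.layer (0 + (1 + 1))), ((y : ↥(κP.layer (0 + (1 + 1)))) :
              AlgebraicClosure ↥(fixedField (MulAction.stabilizer (absoluteGaloisGroup ℚ) P) : IntermediateField ℚ (AlgebraicClosure ℚ))) ∈
              κP.layer (0 + 1) → σ y = y)
          (x' : ClassGroup (𝓞 ↥(κP.layer (0 + (1 + 1))))), x = ClassGroup.mulEquiv (AmbiguousClass.intAut σ) x' * x'⁻¹}).index ≤ 3 ^ 2)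
    (κ : ZpExtension ℚ 3) (hκ : κ.IsCyclotomic) :
    ∃ (γ : absoluteGaloisGroup ℚ) (Df : W.FineSelmerDualData κ γ),
      Module.Finite ℤ_[3] (RestrictScalars ℤ_[3] (IwasawaAlgebra 3) Df.X) := by
  subst hWeq
  exact conjA_three_of_Δ_eq_cube_of_coinvariant_index_le _ irr_g406593n1_3 WildFineSelmerLayerOneL5Records.Δ_cube_g406593n1 P hP0 hco κ hκ

/-- **RECORD — U₀ `ord₃ #Ш(E) ≤ ord₃ #Ш(E)_an` for `E = 406593n1` at `p = 3` on the fact-free door L12** (U₀-ns row of K9 items 19189 / 19197; a further independent road): KERNEL `classO6_g406593n1_3`,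
`irr_g406593n1_3`, `WildFineSelmerLayerOneL5Records.Δ_cube_g406593n1`; DISPLAYED named facts `hKatoA hGZK hmod` ONLY, Cremona's `r_an = 0` (`hr`), and `hco` (kit j316734, GRH). Per row; nothing booked;
BSD is not proved by this. [cite: Kato2004Asterisque, Thm. 14.5 (3) (p. 236) and Prop. 14.16 (2)] [cite: CoatesSujatha2005, §3 Thm. 3.4]
[cite: Cremona2006, Table 1 (Cremona label 406593n1)] -/
theorem missingUpperBoundAt_g406593n1_3_L12
    (hKatoA : Kato2004.rankZero_padicValNat_sha_add_padicValNat_tamagawa_le_of_additive_potGood_of_irreducible_of_fineSelmerDual_fg)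
    (hGZK : rank_eq_analyticRank_of_analyticRank_le_one) (hmod : hasEntireLFunction_rat)
    {W : WeierstrassCurve ℚ} [W.IsElliptic] [W.IsGloballyMinimal] (hWeq : W = (⟨1, (-1), 0, (-3309), (-103944)⟩ : WeierstrassCurve ℚ))
    (hr : W.analyticRank = 0) (P : ↥(W.geomTorsion ((3 : ℕ) : ℤ))) (hP0 : P ≠ 0)
    (hco : ∀ κP : ZpExtension ↥(fixedField (MulAction.stabilizer (absoluteGaloisGroup ℚ) P) :
        IntermediateField ℚ (AlgebraicClosure ℚ)) 3, κP.IsCyclotomic →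
      ((powMonoidHom 3 : ClassGroup (𝓞 ↥(κP.layer (0 + (1 + 1)))) →* ClassGroup (𝓞 ↥(κP.layer (0 + (1 + 1))))).range ⊔
        Subgroup.closure {x | ∃ (σ : ↥(κP.layer (0 + (1 + 1))) ≃ₐ[↥(fixedField (MulAction.stabilizer (absoluteGaloisGroup ℚ) P) :
              IntermediateField ℚ (AlgebraicClosure ℚ))] ↥(κP.layer (0 + (1 + 1))))
          (_ : ∀ y : ↥(κP.layer (0 + (1 + 1))), ((y : ↥(κP.layer (0 + (1 + 1)))) :
              AlgebraicClosure ↥(fixedField (MulAction.stabilizer (absoluteGaloisGroup ℚ) P) : IntermediateField ℚ (AlgebraicClosure ℚ))) ∈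
              κP.layer (0 + 1) → σ y = y)
          (x' : ClassGroup (𝓞 ↥(κP.layer (0 + (1 + 1))))), x = ClassGroup.mulEquiv (AmbiguousClass.intAut σ) x' * x'⁻¹}).index ≤ 3 ^ 2) :
    MissingUpperBoundAt W 3 := by
  subst hWeq
  exact missingUpperBoundAt_three_of_Δ_eq_cube_of_coinvariant_index_le hKatoA hGZK hmod _ hr classO6_g406593n1_3 irr_g406593n1_3
    WildFineSelmerLayerOneL5Records.Δ_cube_g406593n1 P hP0 hco


end Summit.BirchSwinnertonDyer.BirchSwinnertonDyer.Theorems.WildFineSelmerCoinvariantL12Records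

end
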